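import Summits.QuantumFields.YangMills.Theorems.BalabanLadderIRTypExcessSparse
import Literature.MathematicalPhysics.QuantumFieldTheory.LatticeGaugeShenZhuZhuProofs
import HarnessLib

/-!
# The interior local Dirichlet-excess class `Typ_lx^int` of a cell: definitions, cell-locality, exact interior immunity

Support file for crux `IR` = stmt-QuantumFields-19354 (route-QuantumFields-BalabanLadder), registered line «af-pincer-Uc»
(`pub/ym-beyond/p2-g28-files/line-af-pincer-Uc.reg.lean` b6e69d9662b5b07a; stubs `stub_onsetUc` / `stub_typCriterionUc` /
`stub_afOnsetUc`).  Count-neutral helper (`--supports stmt-QuantumFields-19354`); it closes no stub.  Part 1 of 2 (part 2,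
`…IRTypLocalExcessMeas`, carries frame covariance, closedness / measurability and the working class `diluteTyp ∩ Typ_lx^int`).

PROVENANCE.  This is the PORT asked for by the route owner (ruling R72, «lead's first move (1)») of the crux-ideate seat
`ym-19354-certideate-1` GEN 10 desk sketch `Sketch-g10.lean` (sha16 6da5ef98f9b9ac04) §1–§3, by the line's lead prover.
Changes against the desk bytes: namespace `…Theorems.IRTypLocalExcess`; the plaquette-action bookkeeping of its §1 that is
ALREADY in the tree (`OddTorusChessboard.plaqAction`, `plaqAction_congr`, `plaqAction_one`, `plaquetteEdges_subset_of_mem_cellPlaqs`,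
`plaquetteHolonomyZd_congr`; files `…IRTypBallSparse` / `…IRTypExcessSparse`) is IMPORTED instead of re-declared; the GEN-9
exhibit `gen9_blind_spot` (commentary) is omitted.  Everything else is the desk text.

WHAT IS HERE.  The slot's format asks, per mesh-`b` frame `w`, for ONE cell-indexed family `Typ` with
`(∀ c, MeasurableSet (Typ c)) ∧ (∀ c, DependsOn (· ∈ Typ c) (cellEdges w c))` and clause (i) at EVERY centre
(`ClauseIAll … Typ := ∀ c₀, ClauseI … (shiftFrame w c₀) … (fun c => Typ (c + c₀))`).  For the candidate factor
`Typ_lx^int` («local Dirichlet excess at most `E R` in every INTERIOR `R`-ball, `R ∈ Rs`») this file proves: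
* §2 the definitions (`ballLinks`, `touchedOwnPlaqs`, `dirichletAction`, `pinnedOff`, `LocalExcess`, `IsInteriorBall`,
  `TypLxInt`), cell-locality `typLxInt_dependsOn` (splice argument), non-vacuity `one_mem_typLxInt`, monotonicity;
* §3 on an interior ball the own-Dirichlet functional IS the tree kernel's Dirichlet energy
  (`dirichletAction_eq_wilsonBoundaryAction`), and EXACT INTERIOR IMMUNITY: a constrained (ε-)minimiser of ANY window
  Hamiltonian `wilsonBoundaryAction ρ Λ'`, `Λ' ⊇ ballLinks`, over the pinned class has local excess `0` (`≤ ε`)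
  (`localExcess_zero_of_windowMinimiser`, `localExcess_of_windowApproxMinimiser`) — the blind-rest hypothesis is
  discharged by the Literature's `dependsOn_wilsonBoundaryAction_sub`.

HONEST FRAMING: witness-conjunct and immunity bookkeeping for ONE candidate factor of ONE open stub's hypothesis format
(`stub_onsetUc : OnsetMixingTypicalUKPc`); clause (i) and the rarity target (A′) `SupCellRarityAt … WorkingClass …` are
untouched; the chain above the crux is conditional; nothing here bears on the mass gap or the Clay problem.
All declarations proved (no `sorry`); axioms ⊆ {propext, Classical.choice, Quot.sound}.
-/

set_option autoImplicit false

noncomputable section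

open MeasureTheory Set
open Literature.MathematicalPhysics
open Literature.MathematicalPhysics.QuantumFieldTheory Literature.MathematicalPhysics.QuantumLattice
open Literature.Probability.LatticeModels (Site)
open Summit.QuantumFields.YangMills.Cruxes.IR.Tempered (cellEdges)
open Summit.QuantumFields.YangMills.Theorems.OddTorusChessboard (cellSites cellPlaqs mem_cellSites
  fst_mem_cellSites_of_mem_cellPlaqs plaquetteEdges_subset_of_mem_cellPlaqs plaquetteHolonomyZd_congr plaqAction
  plaqAction_congr plaqAction_one)

namespace Summit.QuantumFields.YangMills.Theorems.IRTypLocalExcess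


/-! ## §1 Plaquette-action bookkeeping (the tree's `OddTorusChessboard.plaqAction`; two small additions) -/

section Concrete

variable {G : Type} [Group G] {N : ℕ} (ρ : G →* Matrix (Fin N) (Fin N) ℂ)

/-- The tree kernel's Hamiltonian `wilsonBoundaryAction` is the sum of the tree's `plaqAction` over the plaquettes touching
the edge set (definitional). -/
theorem wilsonBoundaryAction_eq_sum_plaqAction (Λ : Finset (QuantumLattice.ZdEdge 4)) (U : LGConfig 4 G) :
    wilsonBoundaryAction ρ Λ U = ∑ q ∈ plaquettesTouching Λ, plaqAction ρ q U := rfl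

omit [Group G] in
/-- Membership in `cellPlaqs` from the three corner conditions. -/
theorem mem_cellPlaqs_of_corners {w : Fin 4 → ℤ → ℤ} {c : Fin 4 → ℤ} {q : ZdPlaquette 4}
    (h1 : q.1 ∈ cellSites w c) (hi : q.1 + Pi.single q.2.1.1 1 ∈ cellSites w c)
    (hj : q.1 + Pi.single q.2.1.2 1 ∈ cellSites w c) : q ∈ cellPlaqs w c :=
  Finset.mem_filter.2 ⟨Finset.mem_product.2 ⟨h1, Finset.mem_univ _⟩, hi, hj⟩

/-- The plaquette action of a unitary representation is non-negative (tree `abs_plaquetteObs_le_holds`). -/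
theorem plaqAction_nonneg (hρu : ∀ g, ρ g ∈ Matrix.unitaryGroup (Fin N) ℂ) (q : ZdPlaquette 4) (U : LGConfig 4 G) :
    0 ≤ plaqAction ρ q U := by
  have h := abs_plaquetteObs_le_holds (d := 4) ρ hρu q.1 q.2.1.1 q.2.1.2 U
  unfold plaqAction
  linarith [(abs_le.1 h).2]

/-! ## §2 `Typ_lx` v2 — relaxable links, the OWN-DIRICHLET functional, the junk-free excess event, the interior class

GEN 9 compared the action of the own plaquettes BASED in the `R`-ball (`ballPlaqs`).  The plaquettes that READ a
relaxable link are those TOUCHING the ball's links — including the own plaquettes based one step outside the ball on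
its lower faces, which GEN 9's functional omitted although they are NOT blind to the relaxable links (so GEN 9's
`localExcessLE_zero_of_kernelMinimiser`, whose hypothesis asks the rest of the Hamiltonian to be blind to them, cannot
be instantiated on the kernel's Hamiltonian; exhibit `gen9_blind_spot` of the desk sketch).  v2 sums over
the own plaquettes TOUCHING the relaxable links; on interior balls this IS the tree kernel's Dirichlet energy
`wilsonBoundaryAction ρ (ballLinks …)` (§3), and exact immunity becomes a theorem about `wilsonBoundaryAction` with the
blind-rest hypothesis DISCHARGED by the Literature's `dependsOn_wilsonBoundaryAction_sub`. -/

omit [Group G] in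
/-- The RELAXABLE links of the ball: the cell's own links based in the sup-norm `R`-ball about `x` (a `Finset`, so that
the tree's `plaquettesTouching` / `wilsonBoundaryAction` apply to it; its coercion is GEN 9's `ballEdges`). -/
def ballLinks (w : Fin 4 → ℤ → ℤ) (c : Fin 4 → ℤ) (R : ℕ) (x : Site 4) : Finset (QuantumLattice.ZdEdge 4) :=
  (cellEdges w c).filter fun e => ∀ i, |e.1 i - x i| ≤ (R : ℤ)

omit [Group G] in
/-- The relaxable links are cell links. -/
theorem ballLinks_subset_cellEdges (w : Fin 4 → ℤ → ℤ) (c : Fin 4 → ℤ) (R : ℕ) (x : Site 4) :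
    ballLinks w c R x ⊆ cellEdges w c :=
  Finset.filter_subset _ _

omit [Group G] in
/-- The cell's OWN plaquettes touching a relaxable link. -/
def touchedOwnPlaqs (w : Fin 4 → ℤ → ℤ) (c : Fin 4 → ℤ) (R : ℕ) (x : Site 4) : Finset (ZdPlaquette 4) :=
  (cellPlaqs w c).filter fun q => (plaquetteEdges q ∩ ballLinks w c R x).Nonempty

omit [Group G] in
/-- The touched own plaquettes are own plaquettes. -/
theorem touchedOwnPlaqs_subset_cellPlaqs (w : Fin 4 → ℤ → ℤ) (c : Fin 4 → ℤ) (R : ℕ) (x : Site 4) :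
    touchedOwnPlaqs w c R x ⊆ cellPlaqs w c :=
  Finset.filter_subset _ _

/-- **The own-Dirichlet functional of the ball**: the action of the cell's own plaquettes touching the relaxable links. -/
def dirichletAction (w : Fin 4 → ℤ → ℤ) (R : ℕ) (c : Fin 4 → ℤ) (x : Site 4) (U : LGConfig 4 G) : ℝ :=
  ∑ q ∈ touchedOwnPlaqs w c R x, plaqAction ρ q U

omit [Group G] in
/-- The pinned class of `U` off the finite link set `S`: configurations agreeing with `U` outside `S`. -/
def pinnedOff (S : Finset (QuantumLattice.ZdEdge 4)) (U : LGConfig 4 G) : Set (LGConfig 4 G) :=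
  {V | ∀ e, e ∉ S → V e = U e}

/-- **Local Dirichlet excess at most `E` in the ball about `x`** (junk-free: no `inf`): no re-setting of the relaxable
links, everything else pinned, lowers the own-Dirichlet functional by more than `E`. -/
def LocalExcess (w : Fin 4 → ℤ → ℤ) (R : ℕ) (E : ℝ) (c : Fin 4 → ℤ) (x : Site 4) (U : LGConfig 4 G) : Prop :=
  ∀ V ∈ pinnedOff (ballLinks w c R x) U, dirichletAction ρ w R c x U ≤ dirichletAction ρ w R c x V + E

omit [Group G] in
/-- **Interior ball** (the DEPTH RULE): the sup-norm `(R+1)`-ball about `x` lies in the cell, so that every plaquette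
touching a relaxable link is an own plaquette (§3). -/
def IsInteriorBall (w : Fin 4 → ℤ → ℤ) (c : Fin 4 → ℤ) (R : ℕ) (x : Site 4) : Prop :=
  ∀ y : Site 4, (∀ i, |y i - x i| ≤ (R : ℤ) + 1) → y ∈ cellSites w c

/-- **`Typ_lx^int` — the interior, multi-scale local Dirichlet-excess class of a cell.**  Scales `R ∈ Rs` (e.g. the
hyperbolic family `R₀·2^k ≤ b/3`), scale-dependent budget `E R`, interior balls only. -/
def TypLxInt (w : Fin 4 → ℤ → ℤ) (Rs : Set ℕ) (E : ℕ → ℝ) (c : Fin 4 → ℤ) : Set (LGConfig 4 G) :=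
  {U | ∀ (R : ℕ) (x : Site 4), R ∈ Rs → IsInteriorBall w c R x → LocalExcess ρ w R (E R) c x U}

/-- The own-Dirichlet functional is read off the cell's own edges. -/
theorem dirichletAction_congr {w : Fin 4 → ℤ → ℤ} {R : ℕ} {c : Fin 4 → ℤ} {x : Site 4} {U V : LGConfig 4 G}
    (hUV : ∀ e ∈ (↑(cellEdges w c) : Set (QuantumLattice.ZdEdge 4)), U e = V e) :
    dirichletAction ρ w R c x U = dirichletAction ρ w R c x V := by
  unfold dirichletAction
  refine Finset.sum_congr rfl fun q hq => ?_
  have hq' : q ∈ cellPlaqs w c := touchedOwnPlaqs_subset_cellPlaqs w c R x hq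
  rw [plaqAction_congr ρ q fun e he => hUV e (Finset.mem_coe.2 (plaquetteEdges_subset_of_mem_cellPlaqs hq' he))]

omit [Group G] in
/-- Splice on a finite link set `S`: `V'` on `S`, `U` elsewhere (parametrises `pinnedOff S U`). -/
def spliceOn (S : Finset (QuantumLattice.ZdEdge 4)) (V' U : LGConfig 4 G) : LGConfig 4 G :=
  fun e => if e ∈ S then V' e else U e

omit [Group G] in
/-- On `S` the splice reads the inserted configuration. -/
theorem spliceOn_of_mem {S : Finset (QuantumLattice.ZdEdge 4)} (V' U : LGConfig 4 G) {e : QuantumLattice.ZdEdge 4} (he : e ∈ S) :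
    spliceOn S V' U e = V' e := by
  simp [spliceOn, he]

omit [Group G] in
/-- Off `S` the splice reads the background configuration. -/
theorem spliceOn_of_not_mem {S : Finset (QuantumLattice.ZdEdge 4)} (V' U : LGConfig 4 G) {e : QuantumLattice.ZdEdge 4} (he : e ∉ S) :
    spliceOn S V' U e = U e := by
  simp [spliceOn, he]

omit [Group G] in
/-- A splice is pinned to `U` off `S`. -/
theorem spliceOn_mem_pinnedOff (S : Finset (QuantumLattice.ZdEdge 4)) (V' U : LGConfig 4 G) : spliceOn S V' U ∈ pinnedOff S U :=
  fun _e he => spliceOn_of_not_mem V' U he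

omit [Group G] in
/-- A configuration pinned to `U` off `S` is its own splice onto `U`. -/
theorem spliceOn_eq_of_mem_pinnedOff {S : Finset (QuantumLattice.ZdEdge 4)} {V U : LGConfig 4 G} (hV : V ∈ pinnedOff S U) :
    spliceOn S V U = V := by
  funext e
  by_cases he : e ∈ S
  · exact spliceOn_of_mem V U he
  · rw [spliceOn_of_not_mem V U he, hV e he]

/-- Transport of the excess bound along agreement on the cell's edges (the splice argument of GEN 9, on v2). -/
theorem localExcess_of_agree {w : Fin 4 → ℤ → ℤ} {R : ℕ} {E : ℝ} {c : Fin 4 → ℤ} {x : Site 4}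
    {U U' : LGConfig 4 G} (hUU' : ∀ e ∈ (↑(cellEdges w c) : Set (QuantumLattice.ZdEdge 4)), U e = U' e)
    (hU : LocalExcess ρ w R E c x U) : LocalExcess ρ w R E c x U' := by
  intro V' hV'
  have hV : spliceOn (cellEdges w c) V' U ∈ pinnedOff (ballLinks w c R x) U := by
    intro e he
    by_cases hec : e ∈ cellEdges w c
    · rw [spliceOn_of_mem V' U hec, hV' e he]
      exact (hUU' e (Finset.mem_coe.2 hec)).symm
    · exact spliceOn_of_not_mem V' U hec
  have h1 : dirichletAction ρ w R c x U' = dirichletAction ρ w R c x U := (dirichletAction_congr ρ hUU').symm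
  have h2 : dirichletAction ρ w R c x V' = dirichletAction ρ w R c x (spliceOn (cellEdges w c) V' U) :=
    dirichletAction_congr ρ fun e he => (spliceOn_of_mem V' U (Finset.mem_coe.1 he)).symm
  rw [h1, h2]
  exact hU _ hV

/-- **PROVED — witness conjunct «cell-local»:** `DependsOn (· ∈ Typ_lx^int c) (cellEdges w c)`. -/
theorem typLxInt_dependsOn (w : Fin 4 → ℤ → ℤ) (Rs : Set ℕ) (E : ℕ → ℝ) (c : Fin 4 → ℤ) :
    DependsOn (fun U : LGConfig 4 G => U ∈ TypLxInt ρ w Rs E c) ↑(cellEdges w c) := by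
  intro U U' hUU'
  show (U ∈ TypLxInt ρ w Rs E c) = (U' ∈ TypLxInt ρ w Rs E c)
  refine propext ⟨fun hU R x hR hx => localExcess_of_agree ρ hUU' (hU R x hR hx), fun hU' R x hR hx => ?_⟩
  exact localExcess_of_agree ρ (fun e he => (hUU' e he).symm) (hU' R x hR hx)

/-- **PROVED (non-vacuity).** The trivial configuration is `Typ_lx^int`-typical for unitary `ρ` and non-negative budgets. -/
theorem one_mem_typLxInt (hρu : ∀ g, ρ g ∈ Matrix.unitaryGroup (Fin N) ℂ) (w : Fin 4 → ℤ → ℤ) (Rs : Set ℕ)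
    {E : ℕ → ℝ} (hE : ∀ R ∈ Rs, 0 ≤ E R) (c : Fin 4 → ℤ) : (1 : LGConfig 4 G) ∈ TypLxInt ρ w Rs E c := by
  intro R x hR _ V _
  have h0 : dirichletAction ρ w R c x (1 : LGConfig 4 G) = 0 :=
    Finset.sum_eq_zero fun q _ => plaqAction_one ρ q
  have hV : 0 ≤ dirichletAction ρ w R c x V := Finset.sum_nonneg fun q _ => plaqAction_nonneg ρ hρu q V
  rw [h0]
  linarith [hE R hR]

/-- **PROVED.** `Typ_lx^int` is monotone in the budgets and antitone in the scale set. -/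
theorem typLxInt_mono (w : Fin 4 → ℤ → ℤ) {Rs Rs' : Set ℕ} (hRs : Rs' ⊆ Rs) {E E' : ℕ → ℝ}
    (hE : ∀ R ∈ Rs', E R ≤ E' R) (c : Fin 4 → ℤ) : TypLxInt ρ w Rs E c ⊆ TypLxInt ρ w Rs' E' c := by
  intro U hU R x hR hx V hV
  exact (hU R x (hRs hR) hx V hV).trans (by linarith [hE R hR])

/-! ## §3 Interior balls: own-Dirichlet functional = the kernel's Dirichlet energy; EXACT immunity on `wilsonBoundaryAction` -/

omit [Group G] in
/-- Every own plaquette touching a relaxable link touches the link set (trivial direction). -/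
theorem touchedOwnPlaqs_subset_plaquettesTouching (w : Fin 4 → ℤ → ℤ) (c : Fin 4 → ℤ) (R : ℕ) (x : Site 4) :
    touchedOwnPlaqs w c R x ⊆ plaquettesTouching (ballLinks w c R x) := fun _q hq =>
  mem_plaquettesTouching_iff.2 (Finset.mem_filter.1 hq).2

omit [Group G] in
/-- sup-norm bookkeeping for unit lattice vectors. -/
private theorem abs_single_apply_le (i l : Fin 4) : |(Pi.single i (1 : ℤ) : Fin 4 → ℤ) l| ≤ 1 := by
  by_cases h : l = i
  · subst h; simp
  · simp [h]

omit [Group G] in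
/-- **The depth rule at work:** on an interior ball, EVERY plaquette of `ℤ⁴` touching a relaxable link is one of the
cell's own plaquettes (all its corners lie within sup-distance `R + 1` of the centre). -/
theorem mem_cellPlaqs_of_touching {w : Fin 4 → ℤ → ℤ} {c : Fin 4 → ℤ} {R : ℕ} {x : Site 4}
    (hint : IsInteriorBall w c R x) {q : ZdPlaquette 4} (hq : q ∈ plaquettesTouching (ballLinks w c R x)) :
    q ∈ cellPlaqs w c := by
  obtain ⟨e, he⟩ := mem_plaquettesTouching_iff.1 hq
  obtain ⟨he1, he2⟩ := Finset.mem_inter.1 he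
  have hball : ∀ l, |e.1 l - x l| ≤ (R : ℤ) := (Finset.mem_filter.1 he2).2
  -- any point within sup-distance 1 of the ball point `e.1` is in the cell
  have hnear : ∀ p : Site 4, (∀ l, |p l - e.1 l| ≤ 1) → p ∈ cellSites w c := fun p hp =>
    hint p fun l => by
      have h1 := hp l
      have h2 := hball l
      have h3 := abs_sub_le (p l) (e.1 l) (x l)
      linarith
  have hs : ∀ i l : Fin 4, |(Pi.single i (1 : ℤ) : Fin 4 → ℤ) l| ≤ 1 := abs_single_apply_le
  simp only [plaquetteEdges, Finset.mem_insert, Finset.mem_singleton] at he1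
  rcases he1 with rfl | rfl | rfl | rfl
  · -- e = (q.1, i)
    refine mem_cellPlaqs_of_corners (hnear _ fun l => by simp) (hnear _ fun l => ?_) (hnear _ fun l => ?_)
    · simpa using hs q.2.1.1 l
    · simpa using hs q.2.1.2 l
  · -- e = (q.1 + e_i, j)
    refine mem_cellPlaqs_of_corners (hnear _ fun l => ?_) (hnear _ fun l => by simp) (hnear _ fun l => ?_)
    · have := hs q.2.1.1 l
      simp only [Pi.add_apply, sub_add_eq_sub_sub, sub_self, zero_sub, abs_neg]
      exact this
    · have h1 := hs q.2.1.1 l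
      have h2 := hs q.2.1.2 l
      simp only [Pi.add_apply, add_sub_add_left_eq_sub, Pi.single_apply] at h1 h2 ⊢
      split_ifs <;> simp
  · -- e = (q.1 + e_j, i)
    refine mem_cellPlaqs_of_corners (hnear _ fun l => ?_) (hnear _ fun l => ?_) (hnear _ fun l => by simp)
    · have := hs q.2.1.2 l
      simp only [Pi.add_apply, sub_add_eq_sub_sub, sub_self, zero_sub, abs_neg]
      exact this
    · have h1 := hs q.2.1.1 l
      have h2 := hs q.2.1.2 l
      simp only [Pi.add_apply, add_sub_add_left_eq_sub, Pi.single_apply] at h1 h2 ⊢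
      split_ifs <;> simp
  · -- e = (q.1, j)
    refine mem_cellPlaqs_of_corners (hnear _ fun l => by simp) (hnear _ fun l => ?_) (hnear _ fun l => ?_)
    · simpa using hs q.2.1.1 l
    · simpa using hs q.2.1.2 l

omit [Group G] in
/-- **PROVED.** On an interior ball the own plaquettes touching the relaxable links are ALL the plaquettes touching them. -/
theorem touchedOwnPlaqs_eq_plaquettesTouching {w : Fin 4 → ℤ → ℤ} {c : Fin 4 → ℤ} {R : ℕ} {x : Site 4}
    (hint : IsInteriorBall w c R x) : touchedOwnPlaqs w c R x = plaquettesTouching (ballLinks w c R x) := by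
  refine Finset.Subset.antisymm (touchedOwnPlaqs_subset_plaquettesTouching w c R x) fun q hq => ?_
  exact Finset.mem_filter.2 ⟨mem_cellPlaqs_of_touching hint hq, mem_plaquettesTouching_iff.1 hq⟩

/-- **PROVED.** On an interior ball the own-Dirichlet functional IS the tree kernel's Dirichlet energy of the relaxable
links: `dirichletAction ρ w R c x = wilsonBoundaryAction ρ (ballLinks w c R x)`. -/
theorem dirichletAction_eq_wilsonBoundaryAction {w : Fin 4 → ℤ → ℤ} {c : Fin 4 → ℤ} {R : ℕ} {x : Site 4}
    (hint : IsInteriorBall w c R x) :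
    dirichletAction ρ w R c x = wilsonBoundaryAction (G := G) ρ (ballLinks w c R x) := by
  funext U
  rw [wilsonBoundaryAction_eq_sum_plaqAction, dirichletAction, touchedOwnPlaqs_eq_plaquettesTouching hint]

/-- **PROVED — minimising a window Hamiltonian minimises the Dirichlet energy of the relaxable links.**  For any finite
link set `Λ' ⊇ ballLinks` (the kernel's window), an `ε`-minimiser of `wilsonBoundaryAction ρ Λ'` over the pinned
class of the ball is an `ε`-minimiser of `wilsonBoundaryAction ρ (ballLinks …)` over it: the rest of the Hamiltonian
is BLIND to the relaxable links by the Literature's `dependsOn_wilsonBoundaryAction_sub` (no hypothesis to check). -/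
theorem wilsonBoundaryAction_ball_le_of_window {w : Fin 4 → ℤ → ℤ} {c : Fin 4 → ℤ} {R : ℕ} {x : Site 4}
    {Λ' : Finset (QuantumLattice.ZdEdge 4)} (hΛ : ballLinks w c R x ⊆ Λ') {U : LGConfig 4 G} {ε : ℝ}
    (hmin : ∀ V ∈ pinnedOff (ballLinks w c R x) U,
      wilsonBoundaryAction ρ Λ' U ≤ wilsonBoundaryAction ρ Λ' V + ε) :
    ∀ V ∈ pinnedOff (ballLinks w c R x) U,
      wilsonBoundaryAction ρ (ballLinks w c R x) U ≤ wilsonBoundaryAction ρ (ballLinks w c R x) V + ε := by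
  intro V hV
  have hVU : ∀ e ∈ ((↑(ballLinks w c R x) : Set (QuantumLattice.ZdEdge 4))ᶜ), V e = U e :=
    fun e he => hV e (by simpa using he)
  have hrest : wilsonBoundaryAction ρ Λ' V - wilsonBoundaryAction ρ (ballLinks w c R x) V =
      wilsonBoundaryAction ρ Λ' U - wilsonBoundaryAction ρ (ballLinks w c R x) U :=
    dependsOn_wilsonBoundaryAction_sub (G := G) ρ hΛ hVU
  have h := hmin V hV
  linarith

/-- **PROVED — interior immunity, thermal form, on the tree kernel's Hamiltonian.**  An `ε`-minimiser of the window
Hamiltonian `wilsonBoundaryAction ρ Λ'` (any `Λ' ⊇ ballLinks`) over the pinned class of an INTERIOR ball has local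
Dirichlet excess `≤ ε` there.  No blind-rest hypothesis (cf. GEN 9): it is discharged structurally. -/
theorem localExcess_of_windowApproxMinimiser {w : Fin 4 → ℤ → ℤ} {c : Fin 4 → ℤ} {R : ℕ} {x : Site 4}
    (hint : IsInteriorBall w c R x) {Λ' : Finset (QuantumLattice.ZdEdge 4)} (hΛ : ballLinks w c R x ⊆ Λ') {U : LGConfig 4 G} {ε : ℝ}
    (hmin : ∀ V ∈ pinnedOff (ballLinks w c R x) U,
      wilsonBoundaryAction ρ Λ' U ≤ wilsonBoundaryAction ρ Λ' V + ε) :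
    LocalExcess ρ w R ε c x U := by
  intro V hV
  rw [dirichletAction_eq_wilsonBoundaryAction ρ hint]
  exact wilsonBoundaryAction_ball_le_of_window ρ hΛ hmin V hV

/-- **PROVED — interior immunity, exact (`β = ∞`) form:** a constrained minimiser of the window Hamiltonian (the forced
classical response of the cell to ANY frozen exterior) has local Dirichlet excess ZERO in every interior ball. -/
theorem localExcess_zero_of_windowMinimiser {w : Fin 4 → ℤ → ℤ} {c : Fin 4 → ℤ} {R : ℕ} {x : Site 4}
    (hint : IsInteriorBall w c R x) {Λ' : Finset (QuantumLattice.ZdEdge 4)} (hΛ : ballLinks w c R x ⊆ Λ') {U : LGConfig 4 G}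
    (hmin : ∀ V ∈ pinnedOff (ballLinks w c R x) U, wilsonBoundaryAction ρ Λ' U ≤ wilsonBoundaryAction ρ Λ' V) :
    LocalExcess ρ w R 0 c x U :=
  localExcess_of_windowApproxMinimiser ρ hint hΛ (ε := 0) fun V hV => by simpa using hmin V hV

end Concrete

end Summit.QuantumFields.YangMills.Theorems.IRTypLocalExcess

end
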